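import Summits.HodgeConjecture.HodgeConjecture.Theorems.MumfordRouteXiAssembly               -- ★ `MumfordRouteXi.cmConjugationIsogenyAll_holds`
import Literature.AlgebraicGeometry.ModuliOfAbelianVarieties.SiegelConjugationHomReindex     -- ★ (K-b) re-indexing organ (LA6-p02, p847732)
import Literature.AlgebraicGeometry.ModuliOfAbelianVarieties.SiegelCMRecipCommutesAction     -- ★ `r_cm` commutes with `actMatrix` (LA6-p02, p847866; ED. 2)
import HarnessLib

/-!
# Crux `HLiu418` — P6 sub-line **F0-P6a**, E-line socket `stub_E6`, Σ-GAL half: organ **(K-b)** — THE CM CONJUGATION HOMOMORPHISM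
# IN THE E6-γ KERNEL'S BINDER SHAPE `(f, k, hk, hf)`, with the re-indexing element factored as `r_cm`

Cell `hodgecm-mathlib`, crux `stmt-HodgeConjecture-24832` (HLiu418), E-line `Cruxes/HLiu418/Lines/F0_P6a_PELWitnessE.lean` (socket `stub_E6`,
closer v7 A-p06 (g33) head `stub_E6_of_junction_sigmaAN_sigmaGAL`, Σ-GAL skeleton pen A-p04 (g24), socket `stub_KCM` = (K-a)+(K-b)+(K-c));
LEAD F0P6-plan (g3) L-DEAL v1 §L6: «LA6-p02 ← (K-b) the CM hom `f` + `hf`∕`hk` from ★ `cmConjugationIsogenyAll_holds` re-indexed along the class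
identity».  `--supports stmt-HodgeConjecture-24832`, count-neutral: HC_CM is proved only modulo the 2 remaining named inputs (hLiu418 24832,
h413 24833) until rung 0 closes; this file discharges neither.  Nothing is asserted: no `sorry`, no new definition, no named fact.

WHAT IS PROVED.  ★ `MumfordRouteXi.cmConjugationIsogenyAll_holds` (the main theorem of complex multiplication in the tree's ∀-markings currency,
[Shimura1998] Thm. 18.6 ∕ [Milne2005ShimuraVarieties] Thm. 11.2, PROVED) delivers at a CM special pair `(c, J_h, Φ)`, for `σ ∈ Aut(ℂ/E)` with Artin
correspondent `s` and reciprocity element `r_cm` (matrix `c.cmRecipMatrix Φ E s`), for ALL marked models: `f : σA ⟶ A₂` with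
`f((m.r v)^σ) = m′.r w` whenever `(1·a_h⁻¹) v̂ ≡ (r_cm a_h)⁻¹ ŵ`, `m`, `m′` markings by `[J_h, a_h]`, `[J_h, r_cm a_h]`.  The E6-γ KERNEL ★
`SiegelAdelicMarking.hom_eq_conjFibreIso_hom_of_lifts` ∕ `conjugate_comp_conjFibreIso_eq_of_lifts_of_hom` reads the two fibres through OTHER markings
— `m₁` by `[J₁, r₁]` (the chart at the special point) and `m₂` by `[J₂, r₂]` (the admissible marking at the twist) — in the shape `hk : k ∈ K_δ(N)`,
`hf : (k r₁⁻¹) v̂ ≡ r₂⁻¹ ŵ ⟹ f((m₁.r v)^σ) = m₂.r w`.  With the MOVER LAW of the E-line chart (`AuxChartGS.q_spec` token shape: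
`(qᵢ)_ℝ⁻¹ J_h (qᵢ)_ℝ = Jᵢ`, `(q₁)_𝔸 r₁ K_δ(N) = a_h K_δ(N)`, `(q₂)_𝔸 r₂ K_δ(N) = b₂ K_δ(N)`) and the EXPLICIT twist identity `r_cm a_h = b₂ t`,
`t ∈ K_δ(N)` (★ E3R-U `exists_sliceField_siegelRecipDatum`, explicit form), the generic organ ★ `SiegelAdelicMarking.exists_conjHom_reindex_of_moverLaw`
(LA6-p02, ★ `SiegelConjugationHomReindex`) turns this into:
* `exists_cmConjHom_kernelShape` — `∃ f k, k ∈ K_δ(N) ∧ (q₂)_𝔸 (r₂ k r₁⁻¹) (q₁)_𝔸⁻¹ = r_cm ∧ hf` for `σ : ℂ ≃ₐ[E] ℂ` (conjugation by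
  `(σ.restrictScalars ℚ).toRingEquiv`, the literal currency of ★ `CMConjugationIsogenyAll`);
* `exists_cmConjHom_kernelShape_of_forall_mem_apply_eq` — the same for `σ : ℂ ≃ₐ[ℚ] ℂ` fixing `E` pointwise (the E3R ∕ `AuxChartGS.f_recip` shape;
  conjugation by `σ.toRingEquiv`, the KERNEL's literal currency), by the `σE` promotion of ★ `F0P6aSiegelCarrierReciprocity.smul_q_mk_eq_q_mk_cmRecip_of_forall_mem_apply_eq`;
* `exists_cmConjHom_kernelShape_of_witnesses` — the same from explicit Lemma-5.13 witnesses `γ̂₁ r₁ = a_h k₁`, `γ̂₂ r₂ = (r_cm a_h) k₂`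
  (`conjAct γᵢ Jᵢ = J_h`), `k := k₂⁻¹ k₁`, factorisation `r₂ k r₁⁻¹ = γ̂₂⁻¹ r_cm γ̂₁`.
* ED. 2 `exists_cmConjHom_kernelShape_frame` ∕ `…_frame_of_forall_mem_apply_eq` — THE ONE-CALL FORM: with the datum's CM structure PINNED
  to a rational reading `ρ` (`∀ b, ∃ x, (ρ b)_ℚ = c.actMatrix x`; ★ E3R-U ED. 3 `exists_sliceField_siegelRecipDatum_pinned`) and the two chart readings
  `M₁ b = q₁⁻¹ ρ(b) q₁`, `M₂ b = q₂⁻¹ ρ(b) q₂` (the E-line's `Mρ_frame` at the two representatives), the SAME `(f, k)` also satisfies, for every `b`, the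
  `hℓ` clause of the KERNEL for `(ℓ, ℓ′) := (M₁ b, M₂ b)` — ★ (K-c) `adelicCongr_mulVec_of_frame_intCast` with `hlin` discharged by `g₀ = r_cm` and ★
  `CMStructure.coe_mul_adelicMatrix_actMatrix_comm_of_coe_eq_cmRecipMatrix`.  So `stub_KCM`'s CM-side inputs `(f, hk, hf, hℓ)` come from ONE call.
The middle conjunct is the operand of (K-c) ★ `adelicCongr_mulVec_of_frame`'s `hlin` (it commutes with the adelised frame reading `ρ_𝔸` because
`r_cm` lies in the image of the CM torus); `k` is explicit, so no opaque stabiliser element enters `g₀`.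

[cite: Milne2005ShimuraVarieties, §5 Lemma 5.13 p. 57, §6 Thm. 6.11 pp. 74–75, §11 Thm. 11.2 p. 108, §14 Prop. 14.12 p. 125]
[cite: Shimura1998, §18.6 Thm. 18.6 pp. 124–127] [cite: Deligne1971TravauxShimura, 4.12 (b) pp. 148–149, 4.19 p. 151]
-/

set_option autoImplicit false

-- `Summit.HodgeConjecture.HodgeConjecture.…` repeats `HodgeConjecture` by design (D-0017); the lakefile turns `linter.dupNamespace`
-- off tree-wide (weak option), restated here so stand-alone elaboration is warning-free.
set_option linter.dupNamespace false

noncomputable section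

open Matrix NumberField IsDedekindDomain CategoryTheory
open Literature.AlgebraicGeometry.ModuliOfAbelianVarieties
open Literature.AlgebraicGeometry.Motives (AbelianVariety AlgPoints CMType)
open Literature.NumberTheory.ComplexMultiplication (traceField)
open Literature.AlgebraicGeometry.ShimuraVarieties (UnitaryCanonicalModel.IsArtinCorrespondent)
open Summit.HodgeConjecture.HodgeConjecture.Theorems.MumfordRouteXi (cmConjugationIsogenyAll_holds)

namespace Summit.HodgeConjecture.HodgeConjecture.Theorems.F0P6aCMHomKernelShape

variable {g N : ℕ} {δ : Fin g → ℕ}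

/-! ### §1 Explicit witnesses (Lemma 5.13 shape) -/

/-- **(K-b) FROM EXPLICIT WITNESSES.**  At a CM special pair `(c, J_h, Φ)` with `E ⊇ ∏ E*(Φᵢ)`, `σ ∈ Aut(ℂ/E)` with Artin correspondent `s`,
`r_cm ∈ GSp_δ(𝔸_f)` of matrix `c.cmRecipMatrix Φ E s`, and `a_h ∈ GSp_δ(𝔸_f)`: for complex abelian varieties `A`, `A₂` marked by `[J₁, r₁]`,
`[J₂, r₂]` (`m₁`, `m₂`) and witnesses `γ₁, γ₂ ∈ GSp_δ(ℚ)`, `k₁, k₂ ∈ K_δ(N)` of the class identities `[J_h, a_h] = [J₁, r₁]`,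
`[J_h, r_cm a_h] = [J₂, r₂]` (`γᵢ Jᵢ γᵢ⁻¹ = J_h`, `γ̂₁ r₁ = a_h k₁`, `γ̂₂ r₂ = r_cm a_h k₂`), there is `f : σA ⟶ A₂` with the KERNEL clause for
`k := k₂⁻¹ k₁ ∈ K_δ(N)`, and `r₂ k r₁⁻¹ = γ̂₂⁻¹ r_cm γ̂₁` (★ `cmConjugationIsogenyAll_holds` + ★ `exists_conjHom_reindex_one` + ★ `reindex_mul_mul_inv_eq`).
[cite: Milne2005ShimuraVarieties, §5 Lemma 5.13 p. 57, §11 Thm. 11.2 p. 108, §14 Prop. 14.12 p. 125] [cite: Shimura1998, §18.6 Thm. 18.6 pp. 124–127] -/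
theorem exists_cmConjHom_kernelShape_of_witnesses (hg : 0 < g) (hδ : IsPolarizationType δ)
    (ι : Type) [Fintype ι] [DecidableEq ι] (K : ι → Type) [∀ i, Field (K i)] [∀ i, NumberField (K i)] [∀ i, IsCMField (K i)]
    (c : CMStructure g δ ι K) (Jh : C0pm δ) (Φ : ∀ i, CMType (K i)) (hsp : c.IsSpecial Jh Φ)
    (E : IntermediateField ℚ ℂ) [FiniteDimensional ℚ ↥E] (hE : ∀ i, traceField (Φ i) ≤ E) :
    haveI : NumberField ↥E := NumberField.mk
    ∀ (σ : ℂ ≃ₐ[↥E] ℂ) (s : (FiniteAdeleRing (𝓞 ↥E) ↥E)ˣ),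
      UnitaryCanonicalModel.IsArtinCorrespondent ↥E (algebraMap ↥E ℂ) s σ.toRingEquiv →
      ∀ rcm : ↥(gspFinAdelic δ),
        ((rcm : GL (Fin g ⊕ Fin g) (FiniteAdeleRing (𝓞 ℚ) ℚ)) :
            Matrix (Fin g ⊕ Fin g) (Fin g ⊕ Fin g) (FiniteAdeleRing (𝓞 ℚ) ℚ)) = c.cmRecipMatrix Φ E s →
        ∀ (ah : ↥(gspFinAdelic δ)) {A A₂ : AbelianVariety ℂ} {J₁ J₂ : C0pm δ} {r₁ r₂ k₁ k₂ : ↥(gspFinAdelic δ)}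
          (m₁ : SiegelAdelicMarking J₁ r₁ A) (m₂ : SiegelAdelicMarking J₂ r₂ A₂) (γ₁ γ₂ : ↥(gspRational δ)),
          k₁ ∈ principalLevelSubgroup δ N → k₂ ∈ principalLevelSubgroup δ N →
          conjAct δ (gspRationalToReal δ γ₁) J₁ = Jh → gspRationalToFinAdelic δ γ₁ * r₁ = ah * k₁ →
          conjAct δ (gspRationalToReal δ γ₂) J₂ = Jh → gspRationalToFinAdelic δ γ₂ * r₂ = rcm * ah * k₂ →
          ∃ f : A.conjugate (σ.restrictScalars ℚ).toRingEquiv ⟶ A₂,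
            k₂⁻¹ * k₁ ∈ principalLevelSubgroup δ N ∧
            (r₂ * (k₂⁻¹ * k₁) * r₁⁻¹ : ↥(gspFinAdelic δ)) =
              (gspRationalToFinAdelic δ γ₂)⁻¹ * rcm * gspRationalToFinAdelic δ γ₁ ∧
            ∀ v w : Fin g ⊕ Fin g → ℚ,
              AdelicCongr ((k₂⁻¹ * k₁ * r₁⁻¹ : ↥(gspFinAdelic δ)) : GL (Fin g ⊕ Fin g) finAdeleQ)
                  ((r₂⁻¹ : ↥(gspFinAdelic δ)) : GL (Fin g ⊕ Fin g) finAdeleQ) v w →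
                AlgPoints.map f.hom.hom.hom (A.conjPoints (σ.restrictScalars ℚ).toRingEquiv (m₁.r v)) = m₂.r w := by
  intro σ s hs rcm hrcm ah A A₂ J₁ J₂ r₁ r₂ k₁ k₂ m₁ m₂ γ₁ γ₂ hk₁ hk₂ hJ₁ hr₁ hJ₂ hr₂
  have hK1 : principalLevelSubgroup δ N ≤ principalLevelSubgroup δ 1 := principalLevelSubgroup_anti δ (one_dvd N)
  obtain ⟨f, hf⟩ := SiegelAdelicMarking.exists_conjHom_reindex_one (σ.restrictScalars ℚ).toRingEquiv m₁ m₂ γ₁ γ₂ (hK1 hk₁) (hK1 hk₂)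
    hJ₁ hr₁ hJ₂ hr₂ fun m m' => cmConjugationIsogenyAll_holds g δ hg hδ ι K c Jh Φ hsp E hE σ s hs rcm hrcm ah A A₂ m m'
  refine ⟨f, mul_mem (inv_mem hk₂) hk₁, ?_, hf⟩
  have h := reindex_mul_mul_inv_eq (k₀ := (1 : ↥(gspFinAdelic δ))) γ₁ γ₂ hr₁ hr₂
  rw [mul_one, mul_one, mul_inv_cancel_right] at h
  rw [h, mul_assoc]

/-! ### §2 From the mover law (the `AuxChartGS.q_spec` token shape) and the explicit twist identity -/

/-- **(K-b) FROM THE MOVER LAW — THE CM CONJUGATION HOMOMORPHISM IN THE KERNEL'S BINDER SHAPE.**  Same CM data; movers `q₁, q₂ ∈ GSp_δ(ℚ)` with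
`(qᵢ)_ℝ⁻¹ J_h (qᵢ)_ℝ = Jᵢ` (matrices), `(q₁)_𝔸 · r₁ K_δ(N) = a_h K_δ(N)`, `(q₂)_𝔸 · r₂ K_δ(N) = b₂ K_δ(N)` (the two conjuncts of `AuxChartGS.q_spec` at
the representative of the special point and at that of its twist), and the explicit twist identity `r_cm · a_h = b₂ · t`, `t ∈ K_δ(N)`.  THEN
`∃ f k, k ∈ K_δ(N) ∧ (q₂)_𝔸 · (r₂ k r₁⁻¹) · (q₁)_𝔸⁻¹ = r_cm ∧ ∀ v w, (k r₁⁻¹) v̂ ≡ r₂⁻¹ ŵ → f((m₁.r v)^σ) = m₂.r w` — the `(f, k, hk, hf)` of ★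
`hom_eq_conjFibreIso_hom_of_lifts` and the `hlin` operand of ★ (K-c) `adelicCongr_mulVec_of_frame` (with `(q₁, q₂)` as its movers).
[cite: Milne2005ShimuraVarieties, §5 Lemma 5.13 p. 57, §11 Thm. 11.2 p. 108, §14 Prop. 14.12 p. 125] [cite: Shimura1998, §18.6 Thm. 18.6 pp. 124–127]
[cite: Deligne1971TravauxShimura, 4.19 p. 151] -/
theorem exists_cmConjHom_kernelShape (hg : 0 < g) (hδ : IsPolarizationType δ)
    (ι : Type) [Fintype ι] [DecidableEq ι] (K : ι → Type) [∀ i, Field (K i)] [∀ i, NumberField (K i)] [∀ i, IsCMField (K i)]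
    (c : CMStructure g δ ι K) (Jh : C0pm δ) (Φ : ∀ i, CMType (K i)) (hsp : c.IsSpecial Jh Φ)
    (E : IntermediateField ℚ ℂ) [FiniteDimensional ℚ ↥E] (hE : ∀ i, traceField (Φ i) ≤ E) :
    haveI : NumberField ↥E := NumberField.mk
    ∀ (σ : ℂ ≃ₐ[↥E] ℂ) (s : (FiniteAdeleRing (𝓞 ↥E) ↥E)ˣ),
      UnitaryCanonicalModel.IsArtinCorrespondent ↥E (algebraMap ↥E ℂ) s σ.toRingEquiv →
      ∀ rcm : ↥(gspFinAdelic δ),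
        ((rcm : GL (Fin g ⊕ Fin g) (FiniteAdeleRing (𝓞 ℚ) ℚ)) :
            Matrix (Fin g ⊕ Fin g) (Fin g ⊕ Fin g) (FiniteAdeleRing (𝓞 ℚ) ℚ)) = c.cmRecipMatrix Φ E s →
        ∀ (ah b₂ t : ↥(gspFinAdelic δ)) {A A₂ : AbelianVariety ℂ} {J₁ J₂ : C0pm δ} {r₁ r₂ : ↥(gspFinAdelic δ)}
          (m₁ : SiegelAdelicMarking J₁ r₁ A) (m₂ : SiegelAdelicMarking J₂ r₂ A₂) (q₁ q₂ : ↥(gspRational δ)),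
          conjJ ((((gspRationalToReal δ q₁)⁻¹ : ↥(gspReal δ)) : ↥(gspReal δ)) : GL (Fin g ⊕ Fin g) ℝ)
              (Jh : Matrix (Fin g ⊕ Fin g) (Fin g ⊕ Fin g) ℝ) = (J₁ : Matrix (Fin g ⊕ Fin g) (Fin g ⊕ Fin g) ℝ) →
          gspRationalToFinAdelic δ q₁ • ((r₁ : ↥(gspFinAdelic δ)) : ↥(gspFinAdelic δ) ⧸ principalLevelSubgroup δ N) =
              ((ah : ↥(gspFinAdelic δ)) : ↥(gspFinAdelic δ) ⧸ principalLevelSubgroup δ N) →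
          conjJ ((((gspRationalToReal δ q₂)⁻¹ : ↥(gspReal δ)) : ↥(gspReal δ)) : GL (Fin g ⊕ Fin g) ℝ)
              (Jh : Matrix (Fin g ⊕ Fin g) (Fin g ⊕ Fin g) ℝ) = (J₂ : Matrix (Fin g ⊕ Fin g) (Fin g ⊕ Fin g) ℝ) →
          gspRationalToFinAdelic δ q₂ • ((r₂ : ↥(gspFinAdelic δ)) : ↥(gspFinAdelic δ) ⧸ principalLevelSubgroup δ N) =
              ((b₂ : ↥(gspFinAdelic δ)) : ↥(gspFinAdelic δ) ⧸ principalLevelSubgroup δ N) →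
          t ∈ principalLevelSubgroup δ N → rcm * ah = b₂ * t →
          ∃ (f : A.conjugate (σ.restrictScalars ℚ).toRingEquiv ⟶ A₂) (k : ↥(gspFinAdelic δ)),
            k ∈ principalLevelSubgroup δ N ∧
            (gspRationalToFinAdelic δ q₂ * (r₂ * k * r₁⁻¹) * (gspRationalToFinAdelic δ q₁)⁻¹ : ↥(gspFinAdelic δ)) = rcm ∧
            ∀ v w : Fin g ⊕ Fin g → ℚ,
              AdelicCongr ((k * r₁⁻¹ : ↥(gspFinAdelic δ)) : GL (Fin g ⊕ Fin g) finAdeleQ)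
                  ((r₂⁻¹ : ↥(gspFinAdelic δ)) : GL (Fin g ⊕ Fin g) finAdeleQ) v w →
                AlgPoints.map f.hom.hom.hom (A.conjPoints (σ.restrictScalars ℚ).toRingEquiv (m₁.r v)) = m₂.r w := by
  intro σ s hs rcm hrcm ah b₂ t A A₂ J₁ J₂ r₁ r₂ m₁ m₂ q₁ q₂ hJ₁ hq₁ hJ₂ hq₂ ht hb₂
  obtain ⟨f, k, hk, hg₀, hf⟩ := SiegelAdelicMarking.exists_conjHom_reindex_of_moverLaw (σ.restrictScalars ℚ).toRingEquiv m₁ m₂ q₁ q₂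
    hJ₁ hq₁ hJ₂ hq₂ ht hb₂ fun m m' => cmConjugationIsogenyAll_holds g δ hg hδ ι K c Jh Φ hsp E hE σ s hs rcm hrcm ah A A₂ m m'
  refine ⟨f, k, hk, ?_, hf⟩
  rw [hg₀, mul_inv_cancel_right]

/-- **(K-b) FROM THE MOVER LAW, FOR A `ℚ`-AUTOMORPHISM FIXING `E` POINTWISE** — the shape of ★ E3R-U `exists_sliceField_siegelRecipDatum` (`σ : ℂ ≃ₐ[ℚ] ℂ`,
`σ x = x` on `E`, Artin correspondent read on `σ.toRingEquiv`) and of the KERNEL (conjugation by `σ.toRingEquiv`): promote `σ` to an `E`-algebra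
automorphism (Mathlib `AlgEquiv.ofRingEquiv`, as in ★ `smul_q_mk_eq_q_mk_cmRecip_of_forall_mem_apply_eq`) and apply `exists_cmConjHom_kernelShape`.
[cite: Milne2005ShimuraVarieties, §11 Thm. 11.2 p. 108, §14 Prop. 14.12 p. 125] [cite: Shimura1998, §18.6 Thm. 18.6 pp. 124–127] -/
theorem exists_cmConjHom_kernelShape_of_forall_mem_apply_eq (hg : 0 < g) (hδ : IsPolarizationType δ)
    (ι : Type) [Fintype ι] [DecidableEq ι] (K : ι → Type) [∀ i, Field (K i)] [∀ i, NumberField (K i)] [∀ i, IsCMField (K i)]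
    (c : CMStructure g δ ι K) (Jh : C0pm δ) (Φ : ∀ i, CMType (K i)) (hsp : c.IsSpecial Jh Φ)
    (E : IntermediateField ℚ ℂ) [FiniteDimensional ℚ ↥E] (hE : ∀ i, traceField (Φ i) ≤ E) :
    haveI : NumberField ↥E := NumberField.mk
    ∀ (σ : ℂ ≃ₐ[ℚ] ℂ), (∀ x ∈ E, σ x = x) → ∀ (s : (FiniteAdeleRing (𝓞 ↥E) ↥E)ˣ),
      UnitaryCanonicalModel.IsArtinCorrespondent ↥E (algebraMap ↥E ℂ) s σ.toRingEquiv →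
      ∀ rcm : ↥(gspFinAdelic δ),
        ((rcm : GL (Fin g ⊕ Fin g) (FiniteAdeleRing (𝓞 ℚ) ℚ)) :
            Matrix (Fin g ⊕ Fin g) (Fin g ⊕ Fin g) (FiniteAdeleRing (𝓞 ℚ) ℚ)) = c.cmRecipMatrix Φ E s →
        ∀ (ah b₂ t : ↥(gspFinAdelic δ)) {A A₂ : AbelianVariety ℂ} {J₁ J₂ : C0pm δ} {r₁ r₂ : ↥(gspFinAdelic δ)}
          (m₁ : SiegelAdelicMarking J₁ r₁ A) (m₂ : SiegelAdelicMarking J₂ r₂ A₂) (q₁ q₂ : ↥(gspRational δ)),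
          conjJ ((((gspRationalToReal δ q₁)⁻¹ : ↥(gspReal δ)) : ↥(gspReal δ)) : GL (Fin g ⊕ Fin g) ℝ)
              (Jh : Matrix (Fin g ⊕ Fin g) (Fin g ⊕ Fin g) ℝ) = (J₁ : Matrix (Fin g ⊕ Fin g) (Fin g ⊕ Fin g) ℝ) →
          gspRationalToFinAdelic δ q₁ • ((r₁ : ↥(gspFinAdelic δ)) : ↥(gspFinAdelic δ) ⧸ principalLevelSubgroup δ N) =
              ((ah : ↥(gspFinAdelic δ)) : ↥(gspFinAdelic δ) ⧸ principalLevelSubgroup δ N) →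
          conjJ ((((gspRationalToReal δ q₂)⁻¹ : ↥(gspReal δ)) : ↥(gspReal δ)) : GL (Fin g ⊕ Fin g) ℝ)
              (Jh : Matrix (Fin g ⊕ Fin g) (Fin g ⊕ Fin g) ℝ) = (J₂ : Matrix (Fin g ⊕ Fin g) (Fin g ⊕ Fin g) ℝ) →
          gspRationalToFinAdelic δ q₂ • ((r₂ : ↥(gspFinAdelic δ)) : ↥(gspFinAdelic δ) ⧸ principalLevelSubgroup δ N) =
              ((b₂ : ↥(gspFinAdelic δ)) : ↥(gspFinAdelic δ) ⧸ principalLevelSubgroup δ N) →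
          t ∈ principalLevelSubgroup δ N → rcm * ah = b₂ * t →
          ∃ (f : A.conjugate σ.toRingEquiv ⟶ A₂) (k : ↥(gspFinAdelic δ)),
            k ∈ principalLevelSubgroup δ N ∧
            (gspRationalToFinAdelic δ q₂ * (r₂ * k * r₁⁻¹) * (gspRationalToFinAdelic δ q₁)⁻¹ : ↥(gspFinAdelic δ)) = rcm ∧
            ∀ v w : Fin g ⊕ Fin g → ℚ,
              AdelicCongr ((k * r₁⁻¹ : ↥(gspFinAdelic δ)) : GL (Fin g ⊕ Fin g) finAdeleQ)
                  ((r₂⁻¹ : ↥(gspFinAdelic δ)) : GL (Fin g ⊕ Fin g) finAdeleQ) v w →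
                AlgPoints.map f.hom.hom.hom (A.conjPoints σ.toRingEquiv (m₁.r v)) = m₂.r w := by
  intro σ hσE s hs rcm hrcm ah b₂ t A A₂ J₁ J₂ r₁ r₂ m₁ m₂ q₁ q₂ hJ₁ hq₁ hJ₂ hq₂ ht hb₂
  haveI : NumberField ↥E := NumberField.mk
  -- promote `σ` to an `E`-algebra automorphism of `ℂ`
  let σE : ℂ ≃ₐ[↥E] ℂ := AlgEquiv.ofRingEquiv (f := σ.toRingEquiv) fun x => hσE x x.2
  have h1 : (σE.restrictScalars ℚ).toRingEquiv = σ.toRingEquiv := RingEquiv.ext fun _ => rfl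
  have h2 : σE.toRingEquiv = σ.toRingEquiv := RingEquiv.ext fun _ => rfl
  have hsE : UnitaryCanonicalModel.IsArtinCorrespondent ↥E (algebraMap ↥E ℂ) s σE.toRingEquiv := by rw [h2]; exact hs
  have h := exists_cmConjHom_kernelShape hg hδ ι K c Jh Φ hsp E hE σE s hsE rcm hrcm ah b₂ t m₁ m₂ q₁ q₂ hJ₁ hq₁ hJ₂ hq₂ ht hb₂
  rwa [h1] at h

/-! ### §3 (ED. 2) The one-call form: `(f, k, hf)` together with the `hℓ` clause for every `b` -/

/-- **(K-b)+(K-c) IN ONE CALL — THE CM-SIDE INPUTS `(f, hk, hf, hℓ)` OF THE E6-γ KERNEL.**  Data as in `exists_cmConjHom_kernelShape` (CM special pair,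
`σ ∈ Aut(ℂ/E)`, Artin correspondent, `r_cm`, movers `q₁, q₂` with the mover law, explicit twist identity `r_cm a_h = b₂ t`), plus: `r₂ ∈ K_δ(1)`; a
reading `ρ : B → M_{2g}(ℤ)` of some index type `B` (the E-line's `ρ₀` on `𝓞_F`) PINNED to the CM structure (`∀ b, ∃ x, (ρ b)_ℚ = c.actMatrix x` —
★ E3R-U ED. 3); and the two chart readings `M₁ b = q₁⁻¹ ρ(b) q₁`, `M₂ b = q₂⁻¹ ρ(b) q₂` (rational identities of integral matrices; the E-line's
`AuxChartGS.Mρ_frame` at the representative of the special point and at that of its twist).  THEN there are `f : σA ⟶ A₂` and `k ∈ K_δ(N)` with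
`hf : (k r₁⁻¹) v̂ ≡ r₂⁻¹ ŵ ⟹ f((m₁.r v)^σ) = m₂.r w` AND, for every `b`, `hℓ : (k r₁⁻¹) v̂ ≡ r₂⁻¹ ŵ ⟹ (k r₁⁻¹) (M₁ b · v)^ ≡ r₂⁻¹ (M₂ b · w)^` — exactly
the hypotheses `(f, hk, hf, ℓ := M₁ b, ℓ′ := M₂ b, hℓ)` of ★ `SiegelAdelicMarking.conjugate_comp_conjFibreIso_eq_of_lifts_of_hom`.  Proof: §2 gives `(f, k)` with
`g₀ := (q₂)_𝔸 (r₂ k r₁⁻¹) (q₁)_𝔸⁻¹ = r_cm`; `r_cm` commutes with `(c.actMatrix x)_𝔸 = ρ(b)_𝔸` (★ `coe_mul_adelicMatrix_actMatrix_comm_of_coe_eq_cmRecipMatrix`), which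
is the `hlin` of ★ (K-c) `adelicCongr_mulVec_of_frame_intCast`.
[cite: Milne2005ShimuraVarieties, §11 Thm. 11.2 p. 108 (`E`-linear `α`), §14 Prop. 14.12 p. 125, §6 Thm. 6.11 pp. 74–75] [cite: Kottwitz1992, §5 p. 390]
[cite: Shimura1998, §18.6 Thm. 18.6 pp. 124–127] -/
theorem exists_cmConjHom_kernelShape_frame (hg : 0 < g) (hδ : IsPolarizationType δ)
    (ι : Type) [Fintype ι] [DecidableEq ι] (K : ι → Type) [∀ i, Field (K i)] [∀ i, NumberField (K i)] [∀ i, IsCMField (K i)]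
    (c : CMStructure g δ ι K) (Jh : C0pm δ) (Φ : ∀ i, CMType (K i)) (hsp : c.IsSpecial Jh Φ)
    (E : IntermediateField ℚ ℂ) [FiniteDimensional ℚ ↥E] (hE : ∀ i, traceField (Φ i) ≤ E) :
    haveI : NumberField ↥E := NumberField.mk
    ∀ (σ : ℂ ≃ₐ[↥E] ℂ) (s : (FiniteAdeleRing (𝓞 ↥E) ↥E)ˣ),
      UnitaryCanonicalModel.IsArtinCorrespondent ↥E (algebraMap ↥E ℂ) s σ.toRingEquiv →
      ∀ rcm : ↥(gspFinAdelic δ),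
        ((rcm : GL (Fin g ⊕ Fin g) (FiniteAdeleRing (𝓞 ℚ) ℚ)) :
            Matrix (Fin g ⊕ Fin g) (Fin g ⊕ Fin g) (FiniteAdeleRing (𝓞 ℚ) ℚ)) = c.cmRecipMatrix Φ E s →
        ∀ (ah b₂ t : ↥(gspFinAdelic δ)) {A A₂ : AbelianVariety ℂ} {J₁ J₂ : C0pm δ} {r₁ r₂ : ↥(gspFinAdelic δ)}
          (m₁ : SiegelAdelicMarking J₁ r₁ A) (m₂ : SiegelAdelicMarking J₂ r₂ A₂) (q₁ q₂ : ↥(gspRational δ)),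
          conjJ ((((gspRationalToReal δ q₁)⁻¹ : ↥(gspReal δ)) : ↥(gspReal δ)) : GL (Fin g ⊕ Fin g) ℝ)
              (Jh : Matrix (Fin g ⊕ Fin g) (Fin g ⊕ Fin g) ℝ) = (J₁ : Matrix (Fin g ⊕ Fin g) (Fin g ⊕ Fin g) ℝ) →
          gspRationalToFinAdelic δ q₁ • ((r₁ : ↥(gspFinAdelic δ)) : ↥(gspFinAdelic δ) ⧸ principalLevelSubgroup δ N) =
              ((ah : ↥(gspFinAdelic δ)) : ↥(gspFinAdelic δ) ⧸ principalLevelSubgroup δ N) →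
          conjJ ((((gspRationalToReal δ q₂)⁻¹ : ↥(gspReal δ)) : ↥(gspReal δ)) : GL (Fin g ⊕ Fin g) ℝ)
              (Jh : Matrix (Fin g ⊕ Fin g) (Fin g ⊕ Fin g) ℝ) = (J₂ : Matrix (Fin g ⊕ Fin g) (Fin g ⊕ Fin g) ℝ) →
          gspRationalToFinAdelic δ q₂ • ((r₂ : ↥(gspFinAdelic δ)) : ↥(gspFinAdelic δ) ⧸ principalLevelSubgroup δ N) =
              ((b₂ : ↥(gspFinAdelic δ)) : ↥(gspFinAdelic δ) ⧸ principalLevelSubgroup δ N) →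
          t ∈ principalLevelSubgroup δ N → rcm * ah = b₂ * t →
          r₂ ∈ principalLevelSubgroup δ 1 →
          ∀ {B : Type} (ρ M₁ M₂ : B → Matrix (Fin g ⊕ Fin g) (Fin g ⊕ Fin g) ℤ),
            (∀ b, ∃ x : Π i, K i, (ρ b).map (Int.cast : ℤ → ℚ) = c.actMatrix x) →
            (∀ b, (M₁ b).map (Int.cast : ℤ → ℚ) =
              (((q₁⁻¹ : ↥(gspRational δ)) : GL (Fin g ⊕ Fin g) ℚ) : Matrix (Fin g ⊕ Fin g) (Fin g ⊕ Fin g) ℚ) * (ρ b).map (Int.cast : ℤ → ℚ) *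
                (((q₁ : ↥(gspRational δ)) : GL (Fin g ⊕ Fin g) ℚ) : Matrix (Fin g ⊕ Fin g) (Fin g ⊕ Fin g) ℚ)) →
            (∀ b, (M₂ b).map (Int.cast : ℤ → ℚ) =
              (((q₂⁻¹ : ↥(gspRational δ)) : GL (Fin g ⊕ Fin g) ℚ) : Matrix (Fin g ⊕ Fin g) (Fin g ⊕ Fin g) ℚ) * (ρ b).map (Int.cast : ℤ → ℚ) *
                (((q₂ : ↥(gspRational δ)) : GL (Fin g ⊕ Fin g) ℚ) : Matrix (Fin g ⊕ Fin g) (Fin g ⊕ Fin g) ℚ)) →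
          ∃ (f : A.conjugate (σ.restrictScalars ℚ).toRingEquiv ⟶ A₂) (k : ↥(gspFinAdelic δ)),
            k ∈ principalLevelSubgroup δ N ∧
            (∀ v w : Fin g ⊕ Fin g → ℚ,
              AdelicCongr ((k * r₁⁻¹ : ↥(gspFinAdelic δ)) : GL (Fin g ⊕ Fin g) finAdeleQ)
                  ((r₂⁻¹ : ↥(gspFinAdelic δ)) : GL (Fin g ⊕ Fin g) finAdeleQ) v w →
                AlgPoints.map f.hom.hom.hom (A.conjPoints (σ.restrictScalars ℚ).toRingEquiv (m₁.r v)) = m₂.r w) ∧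
            ∀ (b : B) (v w : Fin g ⊕ Fin g → ℚ),
              AdelicCongr ((k * r₁⁻¹ : ↥(gspFinAdelic δ)) : GL (Fin g ⊕ Fin g) finAdeleQ)
                  ((r₂⁻¹ : ↥(gspFinAdelic δ)) : GL (Fin g ⊕ Fin g) finAdeleQ) v w →
              AdelicCongr ((k * r₁⁻¹ : ↥(gspFinAdelic δ)) : GL (Fin g ⊕ Fin g) finAdeleQ)
                  ((r₂⁻¹ : ↥(gspFinAdelic δ)) : GL (Fin g ⊕ Fin g) finAdeleQ)
                  ((M₁ b).map (Int.cast : ℤ → ℚ) *ᵥ v) ((M₂ b).map (Int.cast : ℤ → ℚ) *ᵥ w) := by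
  intro σ s hs rcm hrcm ah b₂ t A A₂ J₁ J₂ r₁ r₂ m₁ m₂ q₁ q₂ hJ₁ hq₁ hJ₂ hq₂ ht hb₂ hr₂ B ρ M₁ M₂ hρc hM₁ hM₂
  haveI : NumberField ↥E := NumberField.mk
  obtain ⟨f, k, hk, hg₀, hf⟩ :=
    exists_cmConjHom_kernelShape hg hδ ι K c Jh Φ hsp E hE σ s hs rcm hrcm ah b₂ t m₁ m₂ q₁ q₂ hJ₁ hq₁ hJ₂ hq₂ ht hb₂
  refine ⟨f, k, hk, hf, fun b v w hvw => ?_⟩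
  obtain ⟨x, hx⟩ := hρc b
  refine adelicCongr_mulVec_of_frame_intCast hr₂ q₁ q₂ ((ρ b).map (Int.cast : ℤ → ℚ)) (M₁ b) (M₂ b) (hM₁ b) (hM₂ b) ?_ v w hvw
  rw [hg₀, hx]
  exact CMStructure.coe_mul_adelicMatrix_actMatrix_comm_of_coe_eq_cmRecipMatrix c Φ E s hrcm x

/-- **THE ONE-CALL FORM FOR A `ℚ`-AUTOMORPHISM FIXING `E` POINTWISE** (E3R ∕ `AuxChartGS.cm_recip` shape; KERNEL currency `σ.toRingEquiv`).
[cite: Milne2005ShimuraVarieties, §11 Thm. 11.2 p. 108, §14 Prop. 14.12 p. 125] [cite: Kottwitz1992, §5 p. 390] -/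
theorem exists_cmConjHom_kernelShape_frame_of_forall_mem_apply_eq (hg : 0 < g) (hδ : IsPolarizationType δ)
    (ι : Type) [Fintype ι] [DecidableEq ι] (K : ι → Type) [∀ i, Field (K i)] [∀ i, NumberField (K i)] [∀ i, IsCMField (K i)]
    (c : CMStructure g δ ι K) (Jh : C0pm δ) (Φ : ∀ i, CMType (K i)) (hsp : c.IsSpecial Jh Φ)
    (E : IntermediateField ℚ ℂ) [FiniteDimensional ℚ ↥E] (hE : ∀ i, traceField (Φ i) ≤ E) :
    haveI : NumberField ↥E := NumberField.mk
    ∀ (σ : ℂ ≃ₐ[ℚ] ℂ), (∀ x ∈ E, σ x = x) → ∀ (s : (FiniteAdeleRing (𝓞 ↥E) ↥E)ˣ),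
      UnitaryCanonicalModel.IsArtinCorrespondent ↥E (algebraMap ↥E ℂ) s σ.toRingEquiv →
      ∀ rcm : ↥(gspFinAdelic δ),
        ((rcm : GL (Fin g ⊕ Fin g) (FiniteAdeleRing (𝓞 ℚ) ℚ)) :
            Matrix (Fin g ⊕ Fin g) (Fin g ⊕ Fin g) (FiniteAdeleRing (𝓞 ℚ) ℚ)) = c.cmRecipMatrix Φ E s →
        ∀ (ah b₂ t : ↥(gspFinAdelic δ)) {A A₂ : AbelianVariety ℂ} {J₁ J₂ : C0pm δ} {r₁ r₂ : ↥(gspFinAdelic δ)}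
          (m₁ : SiegelAdelicMarking J₁ r₁ A) (m₂ : SiegelAdelicMarking J₂ r₂ A₂) (q₁ q₂ : ↥(gspRational δ)),
          conjJ ((((gspRationalToReal δ q₁)⁻¹ : ↥(gspReal δ)) : ↥(gspReal δ)) : GL (Fin g ⊕ Fin g) ℝ)
              (Jh : Matrix (Fin g ⊕ Fin g) (Fin g ⊕ Fin g) ℝ) = (J₁ : Matrix (Fin g ⊕ Fin g) (Fin g ⊕ Fin g) ℝ) →
          gspRationalToFinAdelic δ q₁ • ((r₁ : ↥(gspFinAdelic δ)) : ↥(gspFinAdelic δ) ⧸ principalLevelSubgroup δ N) =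
              ((ah : ↥(gspFinAdelic δ)) : ↥(gspFinAdelic δ) ⧸ principalLevelSubgroup δ N) →
          conjJ ((((gspRationalToReal δ q₂)⁻¹ : ↥(gspReal δ)) : ↥(gspReal δ)) : GL (Fin g ⊕ Fin g) ℝ)
              (Jh : Matrix (Fin g ⊕ Fin g) (Fin g ⊕ Fin g) ℝ) = (J₂ : Matrix (Fin g ⊕ Fin g) (Fin g ⊕ Fin g) ℝ) →
          gspRationalToFinAdelic δ q₂ • ((r₂ : ↥(gspFinAdelic δ)) : ↥(gspFinAdelic δ) ⧸ principalLevelSubgroup δ N) =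
              ((b₂ : ↥(gspFinAdelic δ)) : ↥(gspFinAdelic δ) ⧸ principalLevelSubgroup δ N) →
          t ∈ principalLevelSubgroup δ N → rcm * ah = b₂ * t →
          r₂ ∈ principalLevelSubgroup δ 1 →
          ∀ {B : Type} (ρ M₁ M₂ : B → Matrix (Fin g ⊕ Fin g) (Fin g ⊕ Fin g) ℤ),
            (∀ b, ∃ x : Π i, K i, (ρ b).map (Int.cast : ℤ → ℚ) = c.actMatrix x) →
            (∀ b, (M₁ b).map (Int.cast : ℤ → ℚ) =
              (((q₁⁻¹ : ↥(gspRational δ)) : GL (Fin g ⊕ Fin g) ℚ) : Matrix (Fin g ⊕ Fin g) (Fin g ⊕ Fin g) ℚ) * (ρ b).map (Int.cast : ℤ → ℚ) *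
                (((q₁ : ↥(gspRational δ)) : GL (Fin g ⊕ Fin g) ℚ) : Matrix (Fin g ⊕ Fin g) (Fin g ⊕ Fin g) ℚ)) →
            (∀ b, (M₂ b).map (Int.cast : ℤ → ℚ) =
              (((q₂⁻¹ : ↥(gspRational δ)) : GL (Fin g ⊕ Fin g) ℚ) : Matrix (Fin g ⊕ Fin g) (Fin g ⊕ Fin g) ℚ) * (ρ b).map (Int.cast : ℤ → ℚ) *
                (((q₂ : ↥(gspRational δ)) : GL (Fin g ⊕ Fin g) ℚ) : Matrix (Fin g ⊕ Fin g) (Fin g ⊕ Fin g) ℚ)) →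
          ∃ (f : A.conjugate σ.toRingEquiv ⟶ A₂) (k : ↥(gspFinAdelic δ)),
            k ∈ principalLevelSubgroup δ N ∧
            (∀ v w : Fin g ⊕ Fin g → ℚ,
              AdelicCongr ((k * r₁⁻¹ : ↥(gspFinAdelic δ)) : GL (Fin g ⊕ Fin g) finAdeleQ)
                  ((r₂⁻¹ : ↥(gspFinAdelic δ)) : GL (Fin g ⊕ Fin g) finAdeleQ) v w →
                AlgPoints.map f.hom.hom.hom (A.conjPoints σ.toRingEquiv (m₁.r v)) = m₂.r w) ∧
            ∀ (b : B) (v w : Fin g ⊕ Fin g → ℚ),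
              AdelicCongr ((k * r₁⁻¹ : ↥(gspFinAdelic δ)) : GL (Fin g ⊕ Fin g) finAdeleQ)
                  ((r₂⁻¹ : ↥(gspFinAdelic δ)) : GL (Fin g ⊕ Fin g) finAdeleQ) v w →
              AdelicCongr ((k * r₁⁻¹ : ↥(gspFinAdelic δ)) : GL (Fin g ⊕ Fin g) finAdeleQ)
                  ((r₂⁻¹ : ↥(gspFinAdelic δ)) : GL (Fin g ⊕ Fin g) finAdeleQ)
                  ((M₁ b).map (Int.cast : ℤ → ℚ) *ᵥ v) ((M₂ b).map (Int.cast : ℤ → ℚ) *ᵥ w) := by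
  intro σ hσE s hs rcm hrcm ah b₂ t A A₂ J₁ J₂ r₁ r₂ m₁ m₂ q₁ q₂ hJ₁ hq₁ hJ₂ hq₂ ht hb₂ hr₂ B ρ M₁ M₂ hρc hM₁ hM₂
  haveI : NumberField ↥E := NumberField.mk
  let σE : ℂ ≃ₐ[↥E] ℂ := AlgEquiv.ofRingEquiv (f := σ.toRingEquiv) fun x => hσE x x.2
  have h1 : (σE.restrictScalars ℚ).toRingEquiv = σ.toRingEquiv := RingEquiv.ext fun _ => rfl
  have h2 : σE.toRingEquiv = σ.toRingEquiv := RingEquiv.ext fun _ => rfl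
  have hsE : UnitaryCanonicalModel.IsArtinCorrespondent ↥E (algebraMap ↥E ℂ) s σE.toRingEquiv := by rw [h2]; exact hs
  have h := exists_cmConjHom_kernelShape_frame hg hδ ι K c Jh Φ hsp E hE σE s hsE rcm hrcm ah b₂ t m₁ m₂ q₁ q₂ hJ₁ hq₁ hJ₂ hq₂ ht hb₂
    hr₂ ρ M₁ M₂ hρc hM₁ hM₂
  rwa [h1] at h

/-! ### §4 (ED. 3) The Σ-GAL socket currency: `σ : ℂ ≃ₐ[Fᵢ] ℂ` (A-p04 (g24) `KCMInputs`, skeleton v1 41d49488 :145–:207) -/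

/-- **THE ONE-CALL FORM IN THE SOCKET'S CURRENCY `σ : ℂ ≃ₐ[Fᵢ] ℂ`** — the Σ-GAL skeleton (`Cruxes/HLiu418/F0P6aSigmaGAL`, `def KCMInputs`) binds the
Galois element as an `Fᵢ`-algebra automorphism of `ℂ` (`Fᵢ` the slice field, any `Algebra Fᵢ ℂ`), reads the CM datum of the E-line field `cm_recip`
through `σ.restrictScalars ℚ` (`∀ x ∈ E, (σ.restrictScalars ℚ) x = x`, Artin correspondent of `(σ.restrictScalars ℚ).toRingEquiv`) and wants the
homomorphism on `A.conjugate σ.toRingEquiv` with `conjPoints σ.toRingEquiv`.  This is §3 `exists_cmConjHom_kernelShape_frame_of_forall_mem_apply_eq` at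
`σ.restrictScalars ℚ`, whose ring equivalence IS `σ.toRingEquiv`.  Output: `∃ f k, k ∈ K_δ(N) ∧ hf ∧ ∀ b, hℓ` — for the socket's `b` take the `b`-th
instance of the last conjunct. [cite: Milne2005ShimuraVarieties, §11 Thm. 11.2 p. 108, §14 Prop. 14.12 p. 125] [cite: Kottwitz1992, §5 p. 390] -/
theorem exists_cmConjHom_kernelShape_frame_of_restrictScalars (hg : 0 < g) (hδ : IsPolarizationType δ)
    (ι : Type) [Fintype ι] [DecidableEq ι] (K : ι → Type) [∀ i, Field (K i)] [∀ i, NumberField (K i)] [∀ i, IsCMField (K i)]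
    (c : CMStructure g δ ι K) (Jh : C0pm δ) (Φ : ∀ i, CMType (K i)) (hsp : c.IsSpecial Jh Φ)
    (E : IntermediateField ℚ ℂ) [FiniteDimensional ℚ ↥E] (hE : ∀ i, traceField (Φ i) ≤ E)
    {Fi : Type} [Field Fi] [NumberField Fi] [Algebra Fi ℂ] :
    haveI : NumberField ↥E := NumberField.mk
    ∀ (σ : ℂ ≃ₐ[Fi] ℂ), (∀ x : ℂ, x ∈ E → (σ.restrictScalars ℚ) x = x) → ∀ (s : (FiniteAdeleRing (𝓞 ↥E) ↥E)ˣ),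
      UnitaryCanonicalModel.IsArtinCorrespondent ↥E (algebraMap ↥E ℂ) s (σ.restrictScalars ℚ).toRingEquiv →
      ∀ rcm : ↥(gspFinAdelic δ),
        ((rcm : GL (Fin g ⊕ Fin g) (FiniteAdeleRing (𝓞 ℚ) ℚ)) :
            Matrix (Fin g ⊕ Fin g) (Fin g ⊕ Fin g) (FiniteAdeleRing (𝓞 ℚ) ℚ)) = c.cmRecipMatrix Φ E s →
        ∀ (ah b₂ t : ↥(gspFinAdelic δ)) {A A₂ : AbelianVariety ℂ} {J₁ J₂ : C0pm δ} {r₁ r₂ : ↥(gspFinAdelic δ)}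
          (m₁ : SiegelAdelicMarking J₁ r₁ A) (m₂ : SiegelAdelicMarking J₂ r₂ A₂) (q₁ q₂ : ↥(gspRational δ)),
          conjJ ((((gspRationalToReal δ q₁)⁻¹ : ↥(gspReal δ)) : ↥(gspReal δ)) : GL (Fin g ⊕ Fin g) ℝ)
              (Jh : Matrix (Fin g ⊕ Fin g) (Fin g ⊕ Fin g) ℝ) = (J₁ : Matrix (Fin g ⊕ Fin g) (Fin g ⊕ Fin g) ℝ) →
          gspRationalToFinAdelic δ q₁ • ((r₁ : ↥(gspFinAdelic δ)) : ↥(gspFinAdelic δ) ⧸ principalLevelSubgroup δ N) =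
              ((ah : ↥(gspFinAdelic δ)) : ↥(gspFinAdelic δ) ⧸ principalLevelSubgroup δ N) →
          conjJ ((((gspRationalToReal δ q₂)⁻¹ : ↥(gspReal δ)) : ↥(gspReal δ)) : GL (Fin g ⊕ Fin g) ℝ)
              (Jh : Matrix (Fin g ⊕ Fin g) (Fin g ⊕ Fin g) ℝ) = (J₂ : Matrix (Fin g ⊕ Fin g) (Fin g ⊕ Fin g) ℝ) →
          gspRationalToFinAdelic δ q₂ • ((r₂ : ↥(gspFinAdelic δ)) : ↥(gspFinAdelic δ) ⧸ principalLevelSubgroup δ N) =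
              ((b₂ : ↥(gspFinAdelic δ)) : ↥(gspFinAdelic δ) ⧸ principalLevelSubgroup δ N) →
          t ∈ principalLevelSubgroup δ N → rcm * ah = b₂ * t →
          r₂ ∈ principalLevelSubgroup δ 1 →
          ∀ {B : Type} (ρ M₁ M₂ : B → Matrix (Fin g ⊕ Fin g) (Fin g ⊕ Fin g) ℤ),
            (∀ b, ∃ x : Π i, K i, (ρ b).map (Int.cast : ℤ → ℚ) = c.actMatrix x) →
            (∀ b, (M₁ b).map (Int.cast : ℤ → ℚ) =
              (((q₁⁻¹ : ↥(gspRational δ)) : GL (Fin g ⊕ Fin g) ℚ) : Matrix (Fin g ⊕ Fin g) (Fin g ⊕ Fin g) ℚ) * (ρ b).map (Int.cast : ℤ → ℚ) *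
                (((q₁ : ↥(gspRational δ)) : GL (Fin g ⊕ Fin g) ℚ) : Matrix (Fin g ⊕ Fin g) (Fin g ⊕ Fin g) ℚ)) →
            (∀ b, (M₂ b).map (Int.cast : ℤ → ℚ) =
              (((q₂⁻¹ : ↥(gspRational δ)) : GL (Fin g ⊕ Fin g) ℚ) : Matrix (Fin g ⊕ Fin g) (Fin g ⊕ Fin g) ℚ) * (ρ b).map (Int.cast : ℤ → ℚ) *
                (((q₂ : ↥(gspRational δ)) : GL (Fin g ⊕ Fin g) ℚ) : Matrix (Fin g ⊕ Fin g) (Fin g ⊕ Fin g) ℚ)) →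
          ∃ (f : A.conjugate σ.toRingEquiv ⟶ A₂) (k : ↥(gspFinAdelic δ)),
            k ∈ principalLevelSubgroup δ N ∧
            (∀ v w : Fin g ⊕ Fin g → ℚ,
              AdelicCongr ((k * r₁⁻¹ : ↥(gspFinAdelic δ)) : GL (Fin g ⊕ Fin g) finAdeleQ)
                  ((r₂⁻¹ : ↥(gspFinAdelic δ)) : GL (Fin g ⊕ Fin g) finAdeleQ) v w →
                AlgPoints.map f.hom.hom.hom (A.conjPoints σ.toRingEquiv (m₁.r v)) = m₂.r w) ∧
            ∀ (b : B) (v w : Fin g ⊕ Fin g → ℚ),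
              AdelicCongr ((k * r₁⁻¹ : ↥(gspFinAdelic δ)) : GL (Fin g ⊕ Fin g) finAdeleQ)
                  ((r₂⁻¹ : ↥(gspFinAdelic δ)) : GL (Fin g ⊕ Fin g) finAdeleQ) v w →
              AdelicCongr ((k * r₁⁻¹ : ↥(gspFinAdelic δ)) : GL (Fin g ⊕ Fin g) finAdeleQ)
                  ((r₂⁻¹ : ↥(gspFinAdelic δ)) : GL (Fin g ⊕ Fin g) finAdeleQ)
                  ((M₁ b).map (Int.cast : ℤ → ℚ) *ᵥ v) ((M₂ b).map (Int.cast : ℤ → ℚ) *ᵥ w) := by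
  intro σ hσE s hs rcm hrcm ah b₂ t A A₂ J₁ J₂ r₁ r₂ m₁ m₂ q₁ q₂ hJ₁ hq₁ hJ₂ hq₂ ht hb₂ hr₂ B ρ M₁ M₂ hρc hM₁ hM₂
  have h1 : (σ.restrictScalars ℚ).toRingEquiv = σ.toRingEquiv := RingEquiv.ext fun _ => rfl
  have h := exists_cmConjHom_kernelShape_frame_of_forall_mem_apply_eq hg hδ ι K c Jh Φ hsp E hE (σ.restrictScalars ℚ) hσE s hs rcm hrcm
    ah b₂ t m₁ m₂ q₁ q₂ hJ₁ hq₁ hJ₂ hq₂ ht hb₂ hr₂ ρ M₁ M₂ hρc hM₁ hM₂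
  rwa [h1] at h

end Summit.HodgeConjecture.HodgeConjecture.Theorems.F0P6aCMHomKernelShape

end
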